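import Mathlib
import Literature.Probability.PointProcesses.LensConsistentLaw
import Literature.MathematicalPhysics.StatisticalMechanics.TransferLevelValue
import HarnessLib

/-!
# Crux `PatternPricedCertificates` (stmt-AtomisticToContinuum-12974), line `registered` — stub `stub_abstractMeanDuality`

This file discharges the registered stub `stub_abstractMeanDuality` (abstract LP duality for means)
of line `registered` for crux stmt-AtomisticToContinuum-12974
(`Summit.AtomisticToContinuum.Crystallization.Theses.FrustrationRangeCertificates.PatternPricedCertificates`).

**Statement.** Let `Ω ⊆ α` be an index set, `K` a set of functions `α → ℝ` closed under `+` and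
real scaling and containing `0`, such that every `k ∈ K` is bounded on `Ω` and no `k ∈ K` is
uniformly negative on `Ω`, and let `a` be bounded on `Ω`. Then there is a *mean* `m` (a linear
functional on all functions `α → ℝ`, non-negative on functions with values in `[0, 1]` on `Ω`,
`m 1 = 1`) vanishing on `K` with `m a ≤ t` whenever `inf_Ω (a + k) < t` for every `k ∈ K`
(i.e. `m a ≤ sup_{k ∈ K} inf_Ω (a + k)`, the dual value).

**Proof (Hahn–Banach, purely algebraic).** On the submodule `W` of `Ω`-bounded functions the
functional `N f := inf {s | ∃ k ∈ K, f + k ≤ s on Ω}` is real-valued (the feasible set contains an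
upper bound of `f`, via `k = 0`, and is bounded below by a lower bound of `f`, because no `k ∈ K`
is uniformly negative), subadditive (`K` is closed under `+`) and positively homogeneous (`K` is
closed under scaling). `exists_extension_of_le_sublinear` extends the partial linear map
`c • a ↦ -c · N (-a)` on `ℝ ∙ a` (`LinearPMap.mkSpanSingleton'`), which is dominated by `N`, to
`g ≤ N` on `W`; then `g k ≤ N k ≤ 0` and `-g k ≤ N (-k) ≤ 0` for `k ∈ K`, `g f ≥ -N (-f) ≥ 0` for
`f ∈ [0, 1]` on `Ω`, `1 ≤ -N (-1) ≤ g 1 ≤ N 1 ≤ 1`, and `g a = -N (-a) ≤ t` under the hypothesis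
of the last clause. Finally `LinearMap.exists_extend` extends `g` linearly to all functions.

No new definitions; nothing is assumed. [folklore]
-/

noncomputable section

open scoped BigOperators Classical Pointwise

namespace Summit.AtomisticToContinuum.Crystallization.Theorems.PatternPricedCertificates

section Helpers

variable {α : Type*} {Ω : Set α} {K : Set (α → ℝ)} {N : (α → ℝ) → ℝ}

/-- If `M ≤ f` on `Ω` and no `k ∈ K` is uniformly negative on `Ω`, then every feasible level `s`
of `f` (`f + k ≤ s` on `Ω` for some `k ∈ K`) satisfies `M ≤ s`. [folklore] -/
theorem abstractMeanDuality_le_of_feasible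
    (hKneg : ∀ k ∈ K, ∀ t : ℝ, t < 0 → ∃ x ∈ Ω, t < k x)
    {f : α → ℝ} {M : ℝ} (hM : ∀ x ∈ Ω, M ≤ f x) {k : α → ℝ} (hk : k ∈ K) {s : ℝ}
    (hs : ∀ x ∈ Ω, f x + k x ≤ s) : M ≤ s := by
  by_contra h
  obtain ⟨x, hx, hlt⟩ := hKneg k hk (s - M) (by linarith [not_le.1 h])
  linarith [hM x hx, hs x hx]

/-- The set of feasible levels of an `Ω`-bounded function is nonempty (`0 ∈ K`). [folklore] -/
theorem abstractMeanDuality_feasible_nonempty (hK0 : (0 : α → ℝ) ∈ K)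
    {f : α → ℝ} (hf : ∃ M : ℝ, ∀ x ∈ Ω, |f x| ≤ M) :
    {s : ℝ | ∃ k ∈ K, ∀ x ∈ Ω, f x + k x ≤ s}.Nonempty := by
  obtain ⟨M, hM⟩ := hf
  refine ⟨M, 0, hK0, fun x hx => ?_⟩
  simpa only [Pi.zero_apply, add_zero] using (abs_le.1 (hM x hx)).2

/-- The set of feasible levels of an `Ω`-bounded function is bounded below (no `k ∈ K` is
uniformly negative on `Ω`). [folklore] -/
theorem abstractMeanDuality_feasible_bddBelow
    (hKneg : ∀ k ∈ K, ∀ t : ℝ, t < 0 → ∃ x ∈ Ω, t < k x)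
    {f : α → ℝ} (hf : ∃ M : ℝ, ∀ x ∈ Ω, |f x| ≤ M) :
    BddBelow {s : ℝ | ∃ k ∈ K, ∀ x ∈ Ω, f x + k x ≤ s} := by
  obtain ⟨M, hM⟩ := hf
  refine ⟨-M, ?_⟩
  rintro s ⟨k, hk, hs⟩
  exact abstractMeanDuality_le_of_feasible hKneg (fun x hx => (abs_le.1 (hM x hx)).1) hk hs

/-- `N f ≤ s` for every feasible level `s` of an `Ω`-bounded function `f`. [folklore] -/
theorem abstractMeanDuality_N_le
    (hN : ∀ f, N f = sInf {s : ℝ | ∃ k ∈ K, ∀ x ∈ Ω, f x + k x ≤ s})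
    (hKneg : ∀ k ∈ K, ∀ t : ℝ, t < 0 → ∃ x ∈ Ω, t < k x)
    {f : α → ℝ} (hf : ∃ M : ℝ, ∀ x ∈ Ω, |f x| ≤ M) {k : α → ℝ} (hk : k ∈ K) {s : ℝ}
    (hs : ∀ x ∈ Ω, f x + k x ≤ s) : N f ≤ s := by
  rw [hN]
  exact csInf_le (abstractMeanDuality_feasible_bddBelow hKneg hf) ⟨k, hk, hs⟩

/-- A common lower bound of the feasible levels of an `Ω`-bounded `f` is `≤ N f`. [folklore] -/
theorem abstractMeanDuality_le_N
    (hN : ∀ f, N f = sInf {s : ℝ | ∃ k ∈ K, ∀ x ∈ Ω, f x + k x ≤ s})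
    (hK0 : (0 : α → ℝ) ∈ K) {f : α → ℝ} (hf : ∃ M : ℝ, ∀ x ∈ Ω, |f x| ≤ M) {b : ℝ}
    (hb : ∀ k ∈ K, ∀ s : ℝ, (∀ x ∈ Ω, f x + k x ≤ s) → b ≤ s) : b ≤ N f := by
  rw [hN]
  exact le_csInf (abstractMeanDuality_feasible_nonempty hK0 hf) fun s ⟨k, hk, hs⟩ => hb k hk s hs

/-- Subadditivity of `N` on `Ω`-bounded functions (`K` is closed under `+`). [folklore] -/
theorem abstractMeanDuality_N_add_le
    (hN : ∀ f, N f = sInf {s : ℝ | ∃ k ∈ K, ∀ x ∈ Ω, f x + k x ≤ s})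
    (hKadd : ∀ k₁ ∈ K, ∀ k₂ ∈ K, k₁ + k₂ ∈ K) (hK0 : (0 : α → ℝ) ∈ K)
    (hKneg : ∀ k ∈ K, ∀ t : ℝ, t < 0 → ∃ x ∈ Ω, t < k x)
    {f g : α → ℝ} (hf : ∃ M : ℝ, ∀ x ∈ Ω, |f x| ≤ M) (hg : ∃ M : ℝ, ∀ x ∈ Ω, |g x| ≤ M) :
    N (f + g) ≤ N f + N g := by
  have hfg : ∃ M : ℝ, ∀ x ∈ Ω, |(f + g) x| ≤ M := by
    obtain ⟨Mf, hMf⟩ := hf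
    obtain ⟨Mg, hMg⟩ := hg
    refine ⟨Mf + Mg, fun x hx => ?_⟩
    rw [Pi.add_apply]
    exact (abs_add_le _ _).trans (add_le_add (hMf x hx) (hMg x hx))
  have h1 : ∀ k₁ ∈ K, ∀ s₁ : ℝ, (∀ x ∈ Ω, f x + k₁ x ≤ s₁) →
      ∀ k₂ ∈ K, ∀ s₂ : ℝ, (∀ x ∈ Ω, g x + k₂ x ≤ s₂) → N (f + g) ≤ s₁ + s₂ := by
    intro k₁ hk₁ s₁ hs₁ k₂ hk₂ s₂ hs₂
    refine abstractMeanDuality_N_le hN hKneg hfg (hKadd k₁ hk₁ k₂ hk₂) fun x hx => ?_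
    simp only [Pi.add_apply]
    linarith [hs₁ x hx, hs₂ x hx]
  have h2 : ∀ k₂ ∈ K, ∀ s₂ : ℝ, (∀ x ∈ Ω, g x + k₂ x ≤ s₂) → N (f + g) - s₂ ≤ N f := by
    intro k₂ hk₂ s₂ hs₂
    refine abstractMeanDuality_le_N hN hK0 hf fun k₁ hk₁ s₁ hs₁ => ?_
    linarith [h1 k₁ hk₁ s₁ hs₁ k₂ hk₂ s₂ hs₂]
  have h3 : N (f + g) - N f ≤ N g :=
    abstractMeanDuality_le_N hN hK0 hg fun k₂ hk₂ s₂ hs₂ => by linarith [h2 k₂ hk₂ s₂ hs₂]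
  linarith

/-- Positive homogeneity of `N` (`K` is closed under scaling). [folklore] -/
theorem abstractMeanDuality_N_smul
    (hN : ∀ f, N f = sInf {s : ℝ | ∃ k ∈ K, ∀ x ∈ Ω, f x + k x ≤ s})
    (hKsmul : ∀ (t : ℝ), ∀ k ∈ K, t • k ∈ K) {c : ℝ} (hc : 0 < c) (f : α → ℝ) :
    N (c • f) = c * N f := by
  have hset : {s : ℝ | ∃ k ∈ K, ∀ x ∈ Ω, (c • f) x + k x ≤ s} =
      c • {s : ℝ | ∃ k ∈ K, ∀ x ∈ Ω, f x + k x ≤ s} := by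
    ext s
    simp only [Set.mem_smul_set, Set.mem_setOf_eq, Pi.smul_apply, smul_eq_mul]
    constructor
    · rintro ⟨k, hk, hks⟩
      refine ⟨c⁻¹ * s, ⟨c⁻¹ • k, hKsmul _ k hk, fun x hx => ?_⟩, mul_inv_cancel_left₀ hc.ne' s⟩
      have h := mul_le_mul_of_nonneg_left (hks x hx) (inv_nonneg.2 hc.le)
      rw [mul_add, inv_mul_cancel_left₀ hc.ne'] at h
      simpa only [Pi.smul_apply, smul_eq_mul] using h
    · rintro ⟨s', ⟨k, hk, hks⟩, rfl⟩
      refine ⟨c • k, hKsmul c k hk, fun x hx => ?_⟩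
      rw [Pi.smul_apply, smul_eq_mul, ← mul_add]
      exact mul_le_mul_of_nonneg_left (hks x hx) hc.le
  rw [hN (c • f), hN f, hset, Real.sInf_smul_of_nonneg hc.le, smul_eq_mul]

/-- `N 0 = 0`. [folklore] -/
theorem abstractMeanDuality_N_zero
    (hN : ∀ f, N f = sInf {s : ℝ | ∃ k ∈ K, ∀ x ∈ Ω, f x + k x ≤ s})
    (hK0 : (0 : α → ℝ) ∈ K) (hKneg : ∀ k ∈ K, ∀ t : ℝ, t < 0 → ∃ x ∈ Ω, t < k x) :
    N 0 = 0 := by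
  have h0 : ∃ M : ℝ, ∀ x ∈ Ω, |(0 : α → ℝ) x| ≤ M := ⟨0, fun x _ => by simp⟩
  refine le_antisymm (abstractMeanDuality_N_le hN hKneg h0 hK0 fun x _ => by simp) ?_
  refine abstractMeanDuality_le_N hN hK0 h0 fun k hk s hs => ?_
  exact abstractMeanDuality_le_of_feasible hKneg (M := 0) (fun x _ => by simp) hk hs

/-- `0 ≤ N f + N (-f)` for an `Ω`-bounded `f`. [folklore] -/
theorem abstractMeanDuality_N_add_neg_nonneg
    (hN : ∀ f, N f = sInf {s : ℝ | ∃ k ∈ K, ∀ x ∈ Ω, f x + k x ≤ s})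
    (hKadd : ∀ k₁ ∈ K, ∀ k₂ ∈ K, k₁ + k₂ ∈ K) (hK0 : (0 : α → ℝ) ∈ K)
    (hKneg : ∀ k ∈ K, ∀ t : ℝ, t < 0 → ∃ x ∈ Ω, t < k x)
    {f : α → ℝ} (hf : ∃ M : ℝ, ∀ x ∈ Ω, |f x| ≤ M) : 0 ≤ N f + N (-f) := by
  have hnf : ∃ M : ℝ, ∀ x ∈ Ω, |(-f) x| ≤ M := by
    obtain ⟨M, hM⟩ := hf
    exact ⟨M, fun x hx => by rw [Pi.neg_apply, abs_neg]; exact hM x hx⟩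
  have h := abstractMeanDuality_N_add_le hN hKadd hK0 hKneg hf hnf
  rwa [add_neg_cancel, abstractMeanDuality_N_zero hN hK0 hKneg] at h

end Helpers

/-- **Abstract LP duality for means (Hahn–Banach).** For an index set `Ω ⊆ α`, a set `K` of
functions closed under `+` and real scaling, containing `0`, with `a` and every `k ∈ K` bounded on
`Ω` and no `k ∈ K` uniformly negative on `Ω`, there is a mean on `Ω` (additive, homogeneous, `≥ 0`
on functions with values in `[0, 1]` on `Ω`, `m 1 = 1`) vanishing on `K` with
`m a ≤ sup_{k ∈ K} inf_Ω (a + k)` (stated pointwise). [folklore] -/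
theorem stub_abstractMeanDuality :
    ∀ (α : Type) (Ω : Set α) (K : Set (α → ℝ)) (a : α → ℝ),
      (∀ k₁ ∈ K, ∀ k₂ ∈ K, k₁ + k₂ ∈ K) → (∀ (t : ℝ), ∀ k ∈ K, t • k ∈ K) → (0 : α → ℝ) ∈ K →
      (∃ M : ℝ, ∀ x ∈ Ω, |a x| ≤ M) → (∀ k ∈ K, ∃ M : ℝ, ∀ x ∈ Ω, |k x| ≤ M) →
      (∀ k ∈ K, ∀ t : ℝ, t < 0 → ∃ x ∈ Ω, t < k x) →
      ∃ m : (α → ℝ) → ℝ,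
        (∀ f₁ f₂ : α → ℝ, m (f₁ + f₂) = m f₁ + m f₂) ∧ (∀ (t : ℝ) (f : α → ℝ), m (t • f) = t * m f) ∧
        (∀ f : α → ℝ, (∀ x ∈ Ω, 0 ≤ f x ∧ f x ≤ 1) → 0 ≤ m f) ∧ m (fun _ => 1) = 1 ∧
        (∀ k ∈ K, m k = 0) ∧
        ∀ t : ℝ, (∀ k ∈ K, ∃ x ∈ Ω, a x + k x < t) → m a ≤ t := by
  intro α Ω K a hKadd hKsmul hK0 ha hKbdd hKneg
  -- the sublinear functional `N` and the submodule `W` of `Ω`-bounded functions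
  obtain ⟨N, hN⟩ : ∃ N : (α → ℝ) → ℝ,
      ∀ f, N f = sInf {s : ℝ | ∃ k ∈ K, ∀ x ∈ Ω, f x + k x ≤ s} := ⟨_, fun _ => rfl⟩
  obtain ⟨W, hW⟩ : ∃ W : Submodule ℝ (α → ℝ), ∀ f, f ∈ W ↔ ∃ M : ℝ, ∀ x ∈ Ω, |f x| ≤ M :=
    ⟨{ carrier := {f | ∃ M : ℝ, ∀ x ∈ Ω, |f x| ≤ M}
       add_mem' := fun {f g} hf hg => by
         obtain ⟨Mf, hMf⟩ := hf
         obtain ⟨Mg, hMg⟩ := hg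
         refine ⟨Mf + Mg, fun x hx => ?_⟩
         rw [Pi.add_apply]
         exact (abs_add_le _ _).trans (add_le_add (hMf x hx) (hMg x hx))
       zero_mem' := ⟨0, fun x _ => by simp⟩
       smul_mem' := fun c {f} hf => by
         obtain ⟨M, hM⟩ := hf
         refine ⟨|c| * M, fun x hx => ?_⟩
         rw [Pi.smul_apply, smul_eq_mul, abs_mul]
         exact mul_le_mul_of_nonneg_left (hM x hx) (abs_nonneg c) }, fun _ => Iff.rfl⟩
  have hWb : ∀ f : W, ∃ M : ℝ, ∀ x ∈ Ω, |(f : α → ℝ) x| ≤ M := fun f => (hW f).1 f.2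
  have ha' : a ∈ W := (hW a).2 ha
  have N0 : N 0 = 0 := abstractMeanDuality_N_zero hN hK0 hKneg
  have N_add : ∀ f g : W, N ((f + g : W) : α → ℝ) ≤ N f + N g := fun f g =>
    abstractMeanDuality_N_add_le hN hKadd hK0 hKneg (hWb f) (hWb g)
  have N_hom : ∀ c : ℝ, 0 < c → ∀ f : W, N ((c • f : W) : α → ℝ) = c * N f := fun c hc f =>
    abstractMeanDuality_N_smul hN hKsmul hc f
  -- the partial linear map `c • a ↦ -c * N (-a)` on `ℝ ∙ a`, dominated by `N`
  have H : ∀ c : ℝ, c • (⟨a, ha'⟩ : W) = 0 → (RingHom.id ℝ) c • (-N (-a)) = 0 := by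
    intro c hc
    rcases smul_eq_zero.1 hc with h | h
    · rw [h, map_zero, zero_smul]
    · have h' : a = 0 := congrArg Subtype.val h
      rw [h', neg_zero, N0, neg_zero, smul_zero]
  have hdom : ∀ z : (LinearPMap.mkSpanSingleton' (σ := RingHom.id ℝ) (⟨a, ha'⟩ : W) (-N (-a)) H).domain,
      LinearPMap.mkSpanSingleton' (σ := RingHom.id ℝ) (⟨a, ha'⟩ : W) (-N (-a)) H z ≤
        N ((z : W) : α → ℝ) := by
    rintro ⟨z, hz⟩
    obtain ⟨c, rfl⟩ := Submodule.mem_span_singleton.1 hz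
    rw [LinearPMap.mkSpanSingleton'_apply]
    simp only [RingHom.id_apply, smul_eq_mul, Submodule.coe_smul]
    change c * -N (-a) ≤ N (c • a)
    rcases lt_trichotomy c 0 with hc | rfl | hc
    · have e : c * -N (-a) = N (c • a) :=
        calc c * -N (-a) = -c * N (-a) := by ring
          _ = N (-c • -a) := (abstractMeanDuality_N_smul hN hKsmul (neg_pos.2 hc) (-a)).symm
          _ = N (c • a) := by rw [neg_smul_neg]
      exact e.le
    · rw [zero_mul, zero_smul, N0]
    · have h1 := abstractMeanDuality_N_smul hN hKsmul hc (-a)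
      have h2 := abstractMeanDuality_N_add_neg_nonneg hN hKadd hK0 hKneg
        ((hW _).1 (W.smul_mem c ha'))
      rw [← smul_neg, h1] at h2
      rw [mul_neg]
      linarith
  obtain ⟨g, hg₁, hg₂⟩ :=
    exists_extension_of_le_sublinear _ (fun f : W => N f) N_hom N_add hdom
  have hgN : ∀ (f : α → ℝ) (hf : f ∈ W), g ⟨f, hf⟩ ≤ N f := fun f hf => hg₂ ⟨f, hf⟩
  have hg_lower : ∀ (f : α → ℝ) (hf : f ∈ W), -N (-f) ≤ g ⟨f, hf⟩ := fun f hf => by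
    have h1 : g (-⟨f, hf⟩) ≤ N (-f) := hg₂ ⟨-f, W.neg_mem hf⟩
    rw [map_neg] at h1
    linarith
  have hga : g ⟨a, ha'⟩ = -N (-a) := by
    have h := hg₁ ⟨⟨a, ha'⟩, Submodule.mem_span_singleton_self _⟩
    rw [LinearPMap.mkSpanSingleton'_apply_self] at h
    exact h
  -- extend `g` linearly to all functions
  obtain ⟨m, hm⟩ := LinearMap.exists_extend g
  have hmW : ∀ (f : α → ℝ) (hf : f ∈ W), m f = g ⟨f, hf⟩ := fun f hf => by
    rw [← hm]
    rfl
  refine ⟨m, fun f₁ f₂ => map_add m f₁ f₂, fun t f => by rw [map_smul, smul_eq_mul], ?_, ?_, ?_, ?_⟩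
  · -- positivity
    intro f hf
    have hfW : f ∈ W :=
      (hW f).2 ⟨1, fun x hx => abs_le.2 ⟨by linarith [(hf x hx).1], (hf x hx).2⟩⟩
    rw [hmW f hfW]
    refine le_trans ?_ (hg_lower f hfW)
    rw [le_neg, neg_zero]
    refine abstractMeanDuality_N_le hN hKneg ((hW _).1 (W.neg_mem hfW)) hK0 (s := 0) fun x hx => ?_
    simp only [Pi.neg_apply, Pi.zero_apply, add_zero, neg_nonpos]
    exact (hf x hx).1
  · -- normalisation
    have h1W : (fun _ => (1 : ℝ)) ∈ W := (hW _).2 ⟨1, fun x _ => by simp⟩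
    rw [hmW _ h1W]
    refine le_antisymm ((hgN _ h1W).trans ?_) (le_trans ?_ (hg_lower _ h1W))
    · exact abstractMeanDuality_N_le hN hKneg ((hW _).1 h1W) hK0 fun x _ => by simp
    · rw [le_neg]
      refine abstractMeanDuality_N_le hN hKneg ((hW _).1 (W.neg_mem h1W)) hK0 fun x _ => ?_
      simp
  · -- `m` vanishes on `K`
    intro k hk
    have hkW : k ∈ W := (hW k).2 (hKbdd k hk)
    rw [hmW k hkW]
    refine le_antisymm ((hgN k hkW).trans ?_) (le_trans ?_ (hg_lower k hkW))
    · refine abstractMeanDuality_N_le hN hKneg ((hW _).1 hkW) (hKsmul (-1) k hk) fun x _ => ?_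
      simp
    · rw [le_neg, neg_zero]
      exact abstractMeanDuality_N_le hN hKneg ((hW _).1 (W.neg_mem hkW)) hk fun x _ => by simp
  · -- the dual bound
    intro t ht
    rw [hmW a ha', hga, neg_le]
    refine abstractMeanDuality_le_N hN hK0 ((hW _).1 (W.neg_mem ha')) fun k hk s hs => ?_
    obtain ⟨x, hx, hlt⟩ := ht ((-1 : ℝ) • k) (hKsmul (-1) k hk)
    have h := hs x hx
    simp only [Pi.neg_apply, Pi.smul_apply, smul_eq_mul, neg_mul, one_mul] at h hlt
    linarith

end Summit.AtomisticToContinuum.Crystallization.Theorems.PatternPricedCertificates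

end
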